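import Summits.RiemannHypothesis.RiemannHypothesis.Theses.SignCone
import Summits.RiemannHypothesis.RiemannHypothesis.Theorems.SignConeSignConeOscillatoryThreshold

/-!
# `OscSingleWindow` (crux stmt-RiemannHypothesis-18012): content threshold `a > 3/2` and non-vacuity
(route `SignCone`; refuter crux-attack record, HELPER file `--supports` — it closes nothing)

The crux `Summit.RiemannHypothesis.RiemannHypothesis.Theses.SignCone.OscSingleWindow` is the unit-slack
sign-cone inequality `-Re F(0) ≤ Re W_ar(F)` for node-nonnegative autocorrelation sums `F = Σᵢ gᵢ ⋆ g̃ᵢ`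
(`supp gᵢ ⊆ [-a, a]`) whose far-field negativity `{|t| ≥ log 2 : Re F(t) < 0}` is NON-EMPTY and confined to ONE
window `T ≤ |t| ≤ T + log 2` with `T ≥ 3`. Two cheap structural facts about its hypothesis set:

* `singleWindow_hypotheses_false_of_le_three_halves` / `oscSingleWindow_upTo_three_halves_vacuous` — for
  `0 < a ≤ 3/2` the hypotheses are CONTRADICTORY: `F` vanishes on `|t| ≥ 2a` (`autocorrSum_eq_zero_of_le`) while
  every far-field negativity point has `|t| ≥ T ≥ 3 ≥ 2a`. So the item restricted to `a ≤ 3/2` holds vacuously and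
  its content lives in `a > 3/2` — in particular it is DISJOINT from the certified rung `OscUpToThirteenTenths`
  (`a ≤ 13/10`), which therefore says nothing about it.
* `exists_singleWindow_test` / `singleWindowClass_nonempty` / `oscSingleWindow_hypotheses_satisfiable` — at
  `a = 7/4` the hypotheses ARE jointly satisfiable (`k = 1`), so the item is not vacuous: the two-bump test
  `w = φ(· + c/2) - φ(· - c/2)` of `SignConeSignConeOscillatoryTwoBump.lean` with `φ = WeilContinuous.moll 131`
  (radius `ρ = 1/132`) and `c = 5 log 2 + 1/66` sits just above the node `log 32 = 5 log 2`; `w ⋆ w̃` VANISHES at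
  every node `log m` (`log 33 - log 32 ≥ 1/33 = 4ρ`), its far-field negativity lies in
  `(5 log 2, 5 log 2 + 1/33) ⊆ [T, T + log 2]` with `T = 5 log 2 ≥ 3`, and `Re (w ⋆ w̃)(c) = -∫φ² < 0`.
  (Informally every `a > 3/2` works, with the dip placed in the gap `(log 20, log 21)`; only `a = 7/4` is
  certified here.)

Reading for provers: the class is a genuine, non-empty sub-class of the oscillatory crux starting at cutoff
`3/2`; node-VANISHING single dips like this witness are harmless (narrow features pay `≍ log(1/ρ)·F(0)` of
archimedean energy), the content is in dips of width comparable to the node gap `≍ e^{-T}`.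
-/

noncomputable section

-- `Summit.RiemannHypothesis.RiemannHypothesis.…` repeats a namespace component by design (D-0017 layout).
set_option linter.dupNamespace false

open scoped BigOperators ComplexConjugate Topology
open Complex MeasureTheory Set Filter

namespace Summit.RiemannHypothesis.RiemannHypothesis.Theorems.OscSingleWindow.Negative

open Literature.NumberTheory.LFunctions
open Summit.RiemannHypothesis.RiemannHypothesis.Theorems.SignCone

variable {k : ℕ}

/-! ## Below `a ≤ 3/2` the single-window class is empty -/

/-- **The single-window hypotheses are contradictory for `a ≤ 3/2`.** If the `gᵢ` are Weil tests supported in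
`[-a, a]` with `0 < a ≤ 3/2` and the far-field negativity of `F = Σᵢ gᵢ ⋆ g̃ᵢ` is confined to a window
`T ≤ |t| ≤ T + log 2` with `T ≥ 3`, then `F` has NO far-field negativity at all (`F = 0` on `|t| ≥ 2a`,
and `2a ≤ 3 ≤ T`). [folklore] -/
theorem singleWindow_hypotheses_false_of_le_three_halves {a : ℝ} (ha : 0 < a) (hle : a ≤ 3 / 2)
    (g : Fin k → ℝ → ℂ) (hg : ∀ i, IsWeilTest (g i)) (hs : ∀ i, tsupport (g i) ⊆ Icc (-a) a)
    (hw : ∃ T : ℝ, 3 ≤ T ∧ ∀ t : ℝ, Real.log 2 ≤ |t| →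
      ((fun t => ∑ i, weilConv (g i) (weilReflect (g i)) t) t).re < 0 → T ≤ |t| ∧ |t| ≤ T + Real.log 2) :
    ¬ ∃ t : ℝ, Real.log 2 ≤ |t| ∧ ((fun t => ∑ i, weilConv (g i) (weilReflect (g i)) t) t).re < 0 := by
  rintro ⟨t, ht, hneg⟩
  obtain ⟨T, hT, hwin⟩ := hw
  have hTt : T ≤ |t| := (hwin t ht hneg).1
  rw [autocorrSum_eq_zero_of_le ha g hg hs (by linarith), Complex.zero_re] at hneg
  exact lt_irrefl _ hneg

/-- The same over Mathlib primitives (the verbatim hypotheses of the route decl `OscSingleWindow`): for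
`0 < a ≤ 3/2` the window hypothesis excludes the oscillation hypothesis, so `OscSingleWindow` restricted to
such cutoffs holds vacuously; its content starts at `a > 3/2`. [folklore] -/
theorem oscSingleWindow_upTo_three_halves_vacuous :
    ∀ a : ℝ, 0 < a → a ≤ 3 / 2 → ∀ (k : ℕ) (g : Fin k → ℝ → ℂ), (∀ i, (ContDiff ℝ ((⊤ : ℕ∞) : WithTop ℕ∞) (g i) ∧ HasCompactSupport (g i)) ∧ tsupport (g i) ⊆ Set.Icc (-a) a) → let F : ℝ → ℂ := fun t => ∑ i, MeasureTheory.convolution (g i) (fun u => (starRingEnd ℂ) ((g i) (-u))) (ContinuousLinearMap.mul ℂ ℂ) MeasureTheory.MeasureSpace.volume t; (∃ T : ℝ, 3 ≤ T ∧ ∀ t : ℝ, Real.log 2 ≤ |t| → (F t).re < 0 → T ≤ |t| ∧ |t| ≤ T + Real.log 2) → ¬ ∃ t : ℝ, Real.log 2 ≤ |t| ∧ (F t).re < 0 :=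
  fun _ ha hle _ g hg hw =>
    singleWindow_hypotheses_false_of_le_three_halves ha hle g (fun i => (hg i).1) (fun i => (hg i).2) hw

/-! ## At `a = 7/4` the single-window class is non-empty -/

/-- `log 32 = 5 log 2`. [folklore] -/
theorem log_thirtytwo : Real.log 32 = 5 * Real.log 2 := by
  rw [show (32 : ℝ) = 2 ^ 5 by norm_num, Real.log_pow]
  push_cast
  ring

/-- `5 log 2 + 1/33 ≤ log 33` (`log (33/32) ≥ 1 - 32/33 = 1/33`). [folklore] -/
theorem log_thirtythree_ge : 5 * Real.log 2 + 1 / 33 ≤ Real.log 33 := by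
  have h := Real.one_sub_inv_le_log_of_pos (x := (33 : ℝ) / 32) (by norm_num)
  rw [Real.log_div (by norm_num) (by norm_num), log_thirtytwo] at h
  norm_num at h ⊢
  linarith

/-- **A single-window test at cutoff `7/4`.** The two-bump test `w = φ(· + c/2) - φ(· - c/2)`,
`φ = WeilContinuous.moll 131` (radius `1/132`), `c = 5 log 2 + 1/66`: a Weil test supported in `[-7/4, 7/4]`
whose autocorrelation vanishes at every node `log m` (`m ≥ 2`), has far-field negativity only in
`5 log 2 < |t| < 5 log 2 + 1/33`, and is negative at `c`. [folklore] -/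
theorem exists_singleWindow_test :
    ∃ g : ℝ → ℂ, IsWeilTest g ∧ tsupport g ⊆ Icc (-(7 / 4 : ℝ)) (7 / 4) ∧
      (∀ m : ℕ, 2 ≤ m → weilConv g (weilReflect g) (Real.log m) = 0) ∧
      (∀ t : ℝ, Real.log 2 ≤ |t| → (weilConv g (weilReflect g) t).re < 0 →
        5 * Real.log 2 < |t| ∧ |t| < 5 * Real.log 2 + 1 / 33) ∧
      Real.log 2 ≤ 5 * Real.log 2 + 1 / 66 ∧
      (weilConv g (weilReflect g) (5 * Real.log 2 + 1 / 66)).re < 0 := by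
  have hρ : (WeilContinuous.bump 131).rOut = 1 / 132 := by
    rw [WeilContinuous.bump_rOut]
    norm_num
  have hlog2 := Real.log_two_gt_d9
  have hlog2' := Real.log_two_lt_d9
  set c : ℝ := 5 * Real.log 2 + 1 / 66 with hc
  have hc0 : 0 ≤ c := by rw [hc]; linarith
  have h2ρ : 2 * (WeilContinuous.bump 131).rOut = 1 / 66 := by rw [hρ]; norm_num
  have hρc : 2 * (WeilContinuous.bump 131).rOut ≤ c := by rw [h2ρ, hc]; linarith
  set w : ℝ → ℂ := fun u => WeilContinuous.moll 131 (u + c / 2) - WeilContinuous.moll 131 (u - c / 2)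
    with hw_def
  have hw : IsWeilTest w := isWeilTest_twoBump 131 c
  have hsupp : tsupport w ⊆
      Icc (-(c / 2 + (WeilContinuous.bump 131).rOut)) (c / 2 + (WeilContinuous.bump 131).rOut) :=
    tsupport_twoBump_subset 131 hc0
  have hzero : ∀ s : ℝ, 2 * (WeilContinuous.bump 131).rOut ≤ s →
      2 * (WeilContinuous.bump 131).rOut ≤ |s - c| → weilConv w (weilReflect w) s = 0 :=
    fun s hs hsc => weilConv_twoBump_eq_zero 131 hc0 hs hsc
  have hnegc : (weilConv w (weilReflect w) c).re < 0 := re_weilConv_twoBump_neg 131 hρc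
  have hre : ∀ s : ℝ, (weilConv w (weilReflect w) (-s)).re = (weilConv w (weilReflect w) s).re := by
    intro s
    rw [← conj_weilConv_weilReflect_neg w s, Complex.conj_re]
  -- the window, for nonnegative heights
  have key : ∀ s : ℝ, 0 ≤ s → Real.log 2 ≤ s → (weilConv w (weilReflect w) s).re < 0 →
      5 * Real.log 2 < s ∧ s < 5 * Real.log 2 + 1 / 33 := by
    intro s _ hs2 hsneg
    have hs66 : 2 * (WeilContinuous.bump 131).rOut ≤ s := by rw [h2ρ]; linarith
    by_contra hcon
    have hfar : 2 * (WeilContinuous.bump 131).rOut ≤ |s - c| := by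
      rw [h2ρ]
      rcases not_and_or.1 hcon with h1 | h1
      · have h1' := not_lt.1 h1
        rw [abs_of_nonpos (by rw [hc]; linarith), hc]
        linarith
      · have h1' := not_lt.1 h1
        rw [abs_of_nonneg (by rw [hc]; linarith), hc]
        linarith
    have h0 := hzero s hs66 hfar
    rw [h0, Complex.zero_re] at hsneg
    exact lt_irrefl _ hsneg
  refine ⟨w, hw, hsupp.trans (Icc_subset_Icc ?_ ?_), ?_, ?_, ?_, hnegc⟩
  · rw [hρ, hc]; linarith
  · rw [hρ, hc]; linarith
  · -- nodes
    intro m hm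
    have hm' : (2 : ℝ) ≤ m := by exact_mod_cast hm
    have hlogm2 : Real.log 2 ≤ Real.log m := Real.log_le_log (by norm_num) hm'
    refine hzero (Real.log m) ?_ ?_
    · rw [h2ρ]; linarith
    · rw [h2ρ]
      rcases le_or_gt m 32 with h32 | h33
      · have h32' : (m : ℝ) ≤ 32 := by exact_mod_cast h32
        have hlm : Real.log m ≤ 5 * Real.log 2 := by
          rw [← log_thirtytwo]
          exact Real.log_le_log (by linarith) h32'
        rw [abs_of_nonpos (by rw [hc]; linarith), hc]
        linarith
      · have h33' : (33 : ℝ) ≤ m := by exact_mod_cast h33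
        have hlm : Real.log 33 ≤ Real.log m := Real.log_le_log (by norm_num) h33'
        have h33log := log_thirtythree_ge
        rw [abs_of_nonneg (by rw [hc]; linarith), hc]
        linarith
  · -- window
    intro t ht hneg
    rcases le_or_gt 0 t with ht0 | ht0
    · rw [abs_of_nonneg ht0] at ht ⊢
      exact key t ht0 ht hneg
    · rw [abs_of_neg ht0] at ht ⊢
      refine key (-t) (by linarith) ht ?_
      rw [hre]
      exact hneg
  · rw [hc]; linarith

/-- **The single-window oscillatory class is non-empty at cutoff `7/4`** (`k = 1`, the test of
`exists_singleWindow_test`; window `T = 5 log 2 ≥ 3`). [folklore] -/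
theorem singleWindowClass_nonempty :
    ∃ (k : ℕ) (g : Fin k → ℝ → ℂ), (∀ i, IsWeilTest (g i) ∧ tsupport (g i) ⊆ Icc (-(7 / 4 : ℝ)) (7 / 4)) ∧
      (∀ n : ℕ, 2 ≤ n → 0 ≤ ((fun t => ∑ i, weilConv (g i) (weilReflect (g i)) t) (Real.log n)).re) ∧
      (∃ T : ℝ, 3 ≤ T ∧ ∀ t : ℝ, Real.log 2 ≤ |t| →
        ((fun t => ∑ i, weilConv (g i) (weilReflect (g i)) t) t).re < 0 → T ≤ |t| ∧ |t| ≤ T + Real.log 2) ∧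
      ∃ t : ℝ, Real.log 2 ≤ |t| ∧ ((fun t => ∑ i, weilConv (g i) (weilReflect (g i)) t) t).re < 0 := by
  obtain ⟨g, hg, hsupp, hnode, hwin, hc2, hneg⟩ := exists_singleWindow_test
  have hlog2 := Real.log_two_gt_d9
  refine ⟨1, fun _ => g, fun _ => ⟨hg, hsupp⟩, fun n hn => ?_, ⟨5 * Real.log 2, by linarith, fun t ht hlt => ?_⟩,
    5 * Real.log 2 + 1 / 66, ?_, ?_⟩
  · simp [hnode n hn]
  · have hlt' : (weilConv g (weilReflect g) t).re < 0 := by simpa using hlt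
    have h := hwin t ht hlt'
    constructor <;> linarith
  · rw [abs_of_nonneg (by linarith)]
    exact hc2
  · simpa using hneg

/-- **`OscSingleWindow` is not vacuous.** Over Mathlib primitives — the verbatim hypotheses of the route decl
at cutoff `a = 7/4`: test-function data, node non-negativity, a single negativity window with `T ≥ 3`, and
far-field oscillation are JOINTLY satisfiable. [folklore] -/
theorem oscSingleWindow_hypotheses_satisfiable :
    ∃ (k : ℕ) (g : Fin k → ℝ → ℂ), (∀ i, (ContDiff ℝ ((⊤ : ℕ∞) : WithTop ℕ∞) (g i) ∧ HasCompactSupport (g i)) ∧ tsupport (g i) ⊆ Set.Icc (-(7 / 4 : ℝ)) (7 / 4)) ∧ let F : ℝ → ℂ := fun t => ∑ i, MeasureTheory.convolution (g i) (fun u => (starRingEnd ℂ) ((g i) (-u))) (ContinuousLinearMap.mul ℂ ℂ) MeasureTheory.MeasureSpace.volume t; (∀ n : ℕ, 2 ≤ n → 0 ≤ (F (Real.log n)).re) ∧ (∃ T : ℝ, 3 ≤ T ∧ ∀ t : ℝ, Real.log 2 ≤ |t| → (F t).re < 0 → T ≤ |t| ∧ |t| ≤ T + Real.log 2) ∧ ∃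 t : ℝ, Real.log 2 ≤ |t| ∧ (F t).re < 0 :=
  singleWindowClass_nonempty

end Summit.RiemannHypothesis.RiemannHypothesis.Theorems.OscSingleWindow.Negative

end
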